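/-
Copyright (c) 2026 the pub-hodgecm-mathlib formalisation cell (harness21).  Prover seat hodgecm-mathlib-B-p14 (g39), 2026-09-01∕02.  «S3-ram» seeding wave (LEAD F0P3a-plan (g12);
owner F0P3a-p06 (g15)); architect A-p16 (g31)'s P-1-ram skeleton v5 (c7e2ff97), STUB P `stub_typeOne_depthOdd_ram` :202 — TOKEN FOR TOKEN.
-/
import Literature.NumberTheory.Rogawski1990.DepthZeroKappaTransferTypeOne                  -- ★ inert clause: brings the eigenframe (E1), ★ `forall_conjLocal_mul_eq_one_of_not_exists_conj_glDiagonal` (E3), `conjLocal_apply_eq_galAdicCompletionMap`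
import Literature.NumberTheory.Rogawski1990.LeviNearOneTwoDeep                              -- ★ `valued_sub_one_le_of_isRoot_charpoly_of_congr_one` (eigenvalues of a matrix `≡ 1 (mod c)`)
import Literature.NumberTheory.Rogawski1990.UnitStableOrbitalIntegralHSideValueStubFrame    -- ★ `eq_or_eq_eval_of_isRoot_of_eigenframe`
import Literature.NumberTheory.Rogawski1990.UnitStableOrbitalIntegralHSideValue             -- ★ `valuation_eq_one_of_galAdicCompletionMap_mul_self`
import Literature.NumberTheory.Rogawski1990.UnitFundamentalLemmaInertFlickerFrame            -- ★ `isUnit_two_integer_iff_valued_eq_one`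
import Literature.NumberTheory.Automorphic.UnitaryRankTwoTorusDepthParityRamified           -- ★ `odd_of_valuation_sub_eq_of_norm_one` (THE parity lemma, abstract valued field)
import Literature.NumberTheory.Automorphic.RamifiedPlaceIntegerInvolution                   -- ★ `exists_integer_involution_complexConj_of_ramified` (`σO`, residual triviality)
import Literature.NumberTheory.Automorphic.RamifiedPlaceAntiFixedUniformizer                -- ★ `exists_uniformizer_galAdicCompletionMap_complexConj_eq_neg_of_ramified` (`σ_w ϖ = −ϖ`)
import Literature.NumberTheory.Automorphic.ValuedFieldValuativeRelBridge                    -- ★ `isUniformizingElement_of_v_eq`, `v_eq_iff_valuation_eq`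
import HarnessLib

/-!
# STUB P of the P-1-ram skeleton v5: at a tame-ramified place the depth `N = ord_w(α − γ)` of a 2-deep non-Levi type-(1) `γ_H` is ODD and `≥ 3`
(Labesse–Langlands 1979 §2 p. 8; Rogawski 1990 §4.9 Lemma 4.9.3)

Topic `NumberTheory/Rogawski1990`; namespace `Literature.NumberTheory.Rogawski1990`.  ONE THEOREM (no definition, no instance, no notation, no named fact, no `sorry`);
kernel lane `--supports stmt-HodgeConjecture-24833`.  Cell `pub/hodgecm-mathlib` (D-0151), crux H413; road «S3-ram» seeding wave, P-1-ram skeleton (α) v5 of A-p16 (g31)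
(`F0/P3a/A-p16/g31/DepthZeroKappaTransferTypeOneRamified.skeleton.v5.A-p16g31.lean`, c7e2ff9713160db6): **STUB P `stub_typeOne_depthOdd_ram` :202** — this file's head has
that stub's binders AND conclusion token for token, so the skeleton closes it by `exact`.  HONEST LABEL: HC_CM is proved only modulo the cell's 2 remaining named inputs
(hLiu418 24832, h413 24833) until rung 0 closes; «S3-ram» is Literature seeding with no books consequence; this file is an assembly over ★ organs.

THE MATHEMATICS.  `H_v = U(Φ₂) × U(Φ₁)` at a tame-ramified non-split place `w ∣ v` (`e(w|v) ≠ 1`, `2 ∈ 𝒪_w^×`).  Let `γ_H = (g, u)` be `G`-regular, NOT of Levi type (no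
`H_v`-conjugate with diagonal `U(Φ₂)`-part), with split eigen-data `α ≠ γ ∈ L_w` of `g_w` of depth `N` (`|α − γ|_w = q_w^{−N}`), inside the 2-deep tube
`ι_v(γ_H)_w ≡ 1 (mod ϖ_w²)`.  Then `N = 2n + 1` with `n ≥ 1`:
* (E1)+(E3) [★ `exists_eigenframe_cmDatum_local_of_isRoot_map_of_separable`, ★ `forall_conjLocal_mul_eq_one_of_not_exists_conj_glDiagonal`]: non-Levi ⇒ the eigenvalues are
  NORM-ONE units, `σ_w α · α = σ_w γ · γ = 1` (else `γ_H` would be `H_v`-conjugate to a diagonal element), so `|α| = |γ| = 1` (★ `valuation_eq_one_of_galAdicCompletionMap_mul_self`);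
* the tube [★ `charpoly_map_endoEmbLocal_apply`: `χ_{ι(γ_H)_w} = χ_{g_w}·(X − u_w)`, ★ `valued_sub_one_le_of_isRoot_charpoly_of_congr_one`]: `|α − 1|, |γ − 1| ≤ |ϖ_w|²`, hence
  `|α − γ| ≤ |ϖ_w|²`, `N ≥ 2`;
* the parity lemma [★ `odd_of_valuation_sub_eq_of_norm_one` with the anti-fixed uniformiser `σ_w ϖ = −ϖ` (★ `exists_uniformizer_galAdicCompletionMap_complexConj_eq_neg_of_ramified`)
  and the residually trivial involution `σO` of `𝒪_w` (★ `exists_integer_involution_complexConj_of_ramified`)]: `N` is ODD.  So `N ≥ 3`, `n = (N − 1)∕2 ≥ 1`.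

## References
* [LabesseLanglands1979] J.-P. Labesse, R. P. Langlands, *L-indistinguishability for SL(2)*, Canad. J. Math. 31 (1979): §2, p. 8 (the ramified torus, odd conductor exponents).
* [Rogawski1990] J. D. Rogawski, *Automorphic Representations of Unitary Groups in Three Variables*, Ann. of Math. Stud. 123 (1990): §4.9 Lemma 4.9.3 p. 56; §3.6 p. 31.
* [CasselsFrohlichANT1967] J. W. S. Cassels, A. Fröhlich (eds.), *Algebraic Number Theory* (1967): Ch. II §10 (integrality of eigenvalues).
-/

set_option autoImplicit false

noncomputable section

open NumberField IsDedekindDomain Matrix Polynomial ValuativeRel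
open Literature.NumberTheory.Automorphic Literature.NumberTheory.Automorphic.UnitaryGroup
open scoped Matrix MatrixGroups ValuativeRel

namespace Literature.NumberTheory.Rogawski1990

set_option maxHeartbeats 800000 in
-- large carrier types (the CM local data of `H_v`)
/-- **STUB P (A-p16 (g31) skeleton v5 :202) — ODD DEPTH ≥ 3 IN THE 2-DEEP TUBE**: for a `G`-regular type-(1) `γ_H` at a tame-ramified non-split place (a root at `w`, not of Levi
type) with `ι_v(γ_H)_w ≡ 1 (mod ϖ_w²)` and split eigen-data `α ≠ γ` of depth `N`, `N = 2n + 1` with `1 ≤ n`.  Binders and conclusion = the stub VERBATIM.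
[cite: LabesseLanglands1979, §2 p. 8] [cite: Rogawski1990, §4.9 Lemma 4.9.3 p. 56; §3.6 p. 31] [cite: CasselsFrohlichANT1967, Ch. II §10] -/
theorem typeOne_depthOdd_ram
    (L : Type) [Field L] [NumberField L] [IsCMField L]
    {v : HeightOneSpectrum (𝓞 ↥(maximalRealSubfield L))} (w : PlacesOver L v)
    (hw : IsCMField.complexConj L • w.1 = w.1) (he : v.asIdeal.ramificationIdx' w.1.asIdeal ≠ 1)
    (h2 : IsUnit (2 : 𝒪[(w.1.adicCompletion L)]))
    {γH : ((cmDatum L 2 (Matrix.of fun i j : Fin 2 => if i.val + j.val + 1 = 2 then (1 : L) else 0)).Local v × (cmDatum L 1 (Matrix.of fun i j : Fin 1 => if i.val + j.val + 1 = 1 then (1 : L) else 0)).Local v)} (hreg : IsLocalGRegular L v γH)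
    (hlev : ¬ (∃ (y : ((cmDatum L 2 (Matrix.of fun i j : Fin 2 => if i.val + j.val + 1 = 2 then (1 : L) else 0)).Local v × (cmDatum L 1 (Matrix.of fun i j : Fin 1 => if i.val + j.val + 1 = 1 then (1 : L) else 0)).Local v)) (d' : Fin 2 → (UnitaryGroup.LocalRing L v)ˣ),
      glDiagonal 2 (UnitaryGroup.LocalRing L v) d' = ((y * γH * y⁻¹).1.val : GL (Fin 2) (UnitaryGroup.LocalRing L v))))
    (α γ : (w.1.adicCompletion L)) (hα : ((((γH.1.val : GL (Fin 2) (UnitaryGroup.LocalRing L v)) : Matrix (Fin 2) (Fin 2) (UnitaryGroup.LocalRing L v)).charpoly).map (Pi.evalRingHom (fun w' : PlacesOver L v => w'.1.adicCompletion L) w)).IsRoot α) (hγ : ((((γH.1.val : GL (Fin 2) (UnitaryGroup.LocalRing L v)) : Matrix (Fin 2) (Fin 2) (UnitaryGroup.LocalRing L v)).charpoly).map (Pi.evalRingHom (fun w' : PlacesOver L v => w'.1.adicCompletion L) w)).IsRoot γ) (hαγ : α ≠ γ)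
    (N : ℕ) (hN : Valued.v (α - γ) = WithZero.exp (-(N : ℤ)))
    (htube : ∀ a b : Fin 3, Valued.v ((((((endoEmbLocal L v γH).val : GL (Fin 3) (UnitaryGroup.LocalRing L v)) : Matrix (Fin 3) (Fin 3) (UnitaryGroup.LocalRing L v)).map
        (Pi.evalRingHom (fun w' : PlacesOver L v => w'.1.adicCompletion L) w)) a b - (1 : Matrix (Fin 3) (Fin 3) (w.1.adicCompletion L)) a b)) ≤ WithZero.exp (-2 : ℤ)) :
    ∃ n : ℕ, N = 2 * n + 1 ∧ 1 ≤ n := by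
  have h2v : Valued.v (2 : (w.1.adicCompletion L)) = 1 := (isUnit_two_integer_iff_valued_eq_one L w.1).1 h2
  -- (R) the anti-fixed uniformiser and the residually trivial involution of `𝒪_w`
  obtain ⟨ϖ, hϖ, hσϖ⟩ := exists_uniformizer_galAdicCompletionMap_complexConj_eq_neg_of_ramified L w hw he h2v
  have hϖ0 : (ϖ : (w.1.adicCompletion L)) ≠ 0 := ϖ.ne_zero
  have hϖ' : IsUniformizingElement (ϖ : (w.1.adicCompletion L)) := isUniformizingElement_of_v_eq hϖ
  obtain ⟨σO, hσO', -, hres, -⟩ := exists_integer_involution_complexConj_of_ramified L v w hw he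
  -- (E1) the eigenframe through `α`; its second eigenvalue at `w` is `γ`
  have hsep : (((γH.1.val : GL (Fin 2) (LocalRing L v)) : Matrix (Fin 2) (Fin 2) (LocalRing L v)).charpoly).Separable :=
    (isRegularElt_fst_snd_of_isLocalGRegular L v γH hreg).1
  obtain ⟨P, u, hP, hu, hu0⟩ := exists_eigenframe_cmDatum_local_of_isRoot_map_of_separable L v w hw γH.1 hα hsep
  have hu1 : u 1 w = γ := by
    rcases eq_or_eq_eval_of_isRoot_of_eigenframe L v w hP hγ with h | h
    · exact absurd (h.trans hu0) (Ne.symm hαγ)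
    · exact h.symm
  -- (E3) non-Levi ⇒ norm-one eigenvalues
  have hnorm := forall_conjLocal_mul_eq_one_of_not_exists_conj_glDiagonal L v w hw hP hu hlev
  have hnw : ∀ i, galAdicCompletionMap (L := L) (IsCMField.complexConj L) hw (u i w) * u i w = 1 := fun i => by
    have h := congrArg (fun x : LocalRing L v => x w) (hnorm i)
    simpa only [Pi.mul_apply, Pi.one_apply, conjLocal_apply_eq_galAdicCompletionMap L v w hw] using h
  have hα1 : galAdicCompletionMap (L := L) (IsCMField.complexConj L) hw α * α = 1 := by have h := hnw 0; rwa [hu0] at h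
  have hγ1 : galAdicCompletionMap (L := L) (IsCMField.complexConj L) hw γ * γ = 1 := by have h := hnw 1; rwa [hu1] at h
  have hvα : valuation (w.1.adicCompletion L) α = 1 := valuation_eq_one_of_galAdicCompletionMap_mul_self L v w hw hα1
  have hvγ : valuation (w.1.adicCompletion L) γ = 1 := valuation_eq_one_of_galAdicCompletionMap_mul_self L v w hw hγ1
  -- the tube: `|α − 1|, |γ − 1| ≤ |ϖ²|`
  have hϖ2 : Valued.v ((ϖ : (w.1.adicCompletion L)) ^ 2) = WithZero.exp (-2 : ℤ) := by
    rw [Valuation.map_pow, hϖ, ← WithZero.exp_nsmul]; norm_num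
  have hc0 : (ϖ : (w.1.adicCompletion L)) ^ 2 ≠ 0 := pow_ne_zero _ hϖ0
  set ιw : Matrix (Fin 3) (Fin 3) (w.1.adicCompletion L) := ((((endoEmbLocal L v γH).val : GL (Fin 3) (UnitaryGroup.LocalRing L v)) : Matrix (Fin 3) (Fin 3) (UnitaryGroup.LocalRing L v)).map (Pi.evalRingHom (fun w' : PlacesOver L v => w'.1.adicCompletion L) w)) with hιw
  have hM : ∀ a b, Valued.v (ιw a b - (1 : Matrix (Fin 3) (Fin 3) (w.1.adicCompletion L)) a b) ≤ Valued.v ((ϖ : (w.1.adicCompletion L)) ^ 2) := fun a b => by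
    rw [hϖ2]; exact htube a b
  have hchar : ιw.charpoly = (((γH.1.val : GL (Fin 2) (UnitaryGroup.LocalRing L v)) : Matrix (Fin 2) (Fin 2) (UnitaryGroup.LocalRing L v)).charpoly).map (Pi.evalRingHom (fun w' : PlacesOver L v => w'.1.adicCompletion L) w) * (X - C (finGammaTwo L v γH w)) := by
    rw [hιw, charpoly_map_endoEmbLocal_apply L w, Matrix.charpoly_map]
  have hrootα : ιw.charpoly.IsRoot α := by
    rw [hchar]; exact Polynomial.root_mul.2 (Or.inl hα)
  have hrootγ : ιw.charpoly.IsRoot γ := by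
    rw [hchar]; exact Polynomial.root_mul.2 (Or.inl hγ)
  have hα2 : Valued.v (α - 1) ≤ WithZero.exp (-2 : ℤ) := by
    rw [← hϖ2]; exact valued_sub_one_le_of_isRoot_charpoly_of_congr_one ιw hc0 hM hrootα
  have hγ2 : Valued.v (γ - 1) ≤ WithZero.exp (-2 : ℤ) := by
    rw [← hϖ2]; exact valued_sub_one_le_of_isRoot_charpoly_of_congr_one ιw hc0 hM hrootγ
  -- `N ≥ 2`
  have hN2 : 2 ≤ N := by
    have hle : Valued.v (α - γ) ≤ WithZero.exp (-2 : ℤ) := by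
      have e : α - γ = (α - 1) - (γ - 1) := by ring
      rw [e]
      exact (Valuation.map_sub _ _ _).trans (max_le hα2 hγ2)
    rw [hN, WithZero.exp_le_exp] at hle
    omega
  -- `N` odd (★ parity lemma in the `ValuativeRel` currency)
  have hN' : valuation (w.1.adicCompletion L) (α - γ) = valuation (w.1.adicCompletion L) ((ϖ : (w.1.adicCompletion L)) ^ N) := by
    rw [← v_eq_iff_valuation_eq, hN, Valuation.map_pow, hϖ, ← WithZero.exp_nsmul]
    simp
  have hodd : Odd N :=
    odd_of_valuation_sub_eq_of_norm_one (galAdicCompletionMap (L := L) (IsCMField.complexConj L) hw) hϖ' hσϖ σO hσO' h2 hres hα1 hγ1 hvα hvγ hN' (by omega)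
  obtain ⟨n, hn⟩ := hodd
  exact ⟨n, hn, by omega⟩

end Literature.NumberTheory.Rogawski1990

end
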